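import Summits.HodgeConjecture.HodgeConjecture.Theses.GenericDivisibility
import Summits.HodgeConjecture.HodgeConjecture.Theorems.GenericDivisibilityGenericDivisibilityBoundedBirationalUp
import Summits.HodgeConjecture.HodgeConjecture.Theorems.GenericDivisibilityHodgeClassesGenericallyDivisible
import Literature.AlgebraicGeometry.HodgeTheory.HodgeTypeExteriorProduct
import Literature.AlgebraicTopology.SingularHomology.IntegralClassRingChange
import HarnessLib

/-!
# Route GenericDivisibility — crux C1 `HodgeClassesGenericallyDivisible` (stmt-HodgeConjecture-18466)
# DESCENDS along birational morphisms of smooth projective varieties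

`σ : X' ⟶ X` is a `ℂ`-morphism of smooth projective `n`-folds with `σ.left` birational (an
isomorphism over a dense open `U ⊆ X`), `f = σ(ℂ)`, `z| = z|_{(X∖Z)(ℂ)}`. "C1 at `X` in degree `k` and
type `(a, b)`" is: every `z ∈ H^k(X(ℂ);ℤ)` whose complexification is of Hodge type `(a, b)` is, for
every `m ≥ 1`, an `m`-multiple on the complex points of some non-empty Zariski open (the crux is
`n = k = 2p`, `(a, b) = (p, p)`).

**Theorem** (`hodgeClassesGenericallyDivisible_at_of_isBirational`). C1 at `X'` implies C1 at `X`.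
So the crux at `X` may be checked on ANY smooth projective birational model dominating `X` (a blow-up,
a resolved pencil, a semistable modification …).

Proof. Pull-backs along morphisms of smooth projective varieties preserve Hodge types (Voisin I
§7.3.2, the tree's `IsOfHodgeType.map_of_isSmoothProjective`), and `(σ^* z) ⊗ ℂ = σ^*(z ⊗ ℂ)`, so
C1 at `X'` gives `m • y' = (σ^* z)|_{(X'∖Z')(ℂ)}`. Over the iso locus `σ(ℂ)` restricts to a
HOMEOMORPHISM `(X' ∖ σ⁻¹T)(ℂ) ≃ₜ (X ∖ T)(ℂ)` for every `T ⊇ X ∖ U` (the landed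
`genericDivisibilityBounded_exists_homeomorph_compl` of the companion crux C2, SGA1 XII), and with
`T = σ(Z') ∪ (X ∖ U)` — closed because `σ` is proper, `≠ X` because `σ` is injective over `U` and `X'`
is irreducible (`…_image_union_isClosed_ne_univ`) — one has `σ⁻¹T ⊇ Z'`; restricting the relation to
`(X' ∖ σ⁻¹T)(ℂ)` and transporting it down along the homeomorphism gives `m • y = z|_{(X∖T)(ℂ)}`.

* `hodgeClassesGenericallyDivisible_at_of_isBirational` — any degree `k`, any type `(a, b)`;
* `stub_hodgeClassesGenericallyDivisible_of_isBirational` — the registered sub-goal of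
  stmt-HodgeConjecture-18466 (`n = k = 2p`, type `(p, p)`), closed form.

References: [VoisinHodgeI2002] §7.3.2 (pull-backs of Hodge structures), Lemma 7.28; [SGA1] XII
Prop. 3.1 (xi); [HatcherAT2002] §3.1; [Spanier1981] Ch. 6 §6.
-/

set_option linter.dupNamespace false

noncomputable section

namespace Summit.HodgeConjecture.HodgeConjecture.Theorems

open CategoryTheory AlgebraicGeometry
open Literature.AlgebraicGeometry.Motives Literature.AlgebraicGeometry.HodgeTheory
  Literature.AlgebraicTopology.SingularHomology

/-- Restriction `H^k(X(ℂ);ℤ) → H^k((X∖Z)(ℂ);ℤ)`, the very term of the route decls (notation only). -/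
local notation3 (prettyPrint := false) "Res[" X ", " Z ", " k "]" =>
  singularCohomology.map ℤ ℤ
    (⟨Subtype.val, continuous_subtype_val⟩ : C(complexPointsCompl X Z, ComplexPoints X)) k

/-- The inclusion `(X ∖ Z')(ℂ) ↪ (X ∖ Z)(ℂ)` for `h : Z ⊆ Z'`, spelled as in
`genericDivisibility_restrict_restrict` (notation only). -/
local notation3 (prettyPrint := false) "Incl[" X ", " Z ", " Z' ", " h "]" =>
  (⟨fun P : complexPointsCompl X Z' => (⟨P.1, fun hP : P.1.pt ∈ Z => P.2 (h hP)⟩ :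
      complexPointsCompl X Z),
    continuous_subtype_val.subtype_mk fun (P : complexPointsCompl X Z') (hP : P.1.pt ∈ Z) =>
      P.2 (h hP)⟩ : C(complexPointsCompl X Z', complexPointsCompl X Z))

variable {n : ℕ} {X' X : SchemeOver ℂ}

/-- **C1 descends along birational morphisms of smooth projective varieties.** Let `σ : X' ⟶ X` be a
`ℂ`-morphism of smooth projective `n`-folds with `σ.left` birational, and suppose that on `X'` every
integral class of degree `k` whose complexification is of Hodge type `(a, b)` is, for every `m ≥ 1`,
an `m`-multiple on the complex points of some non-empty Zariski open. Then the same holds on `X`: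
`σ^* z` is again of type `(a, b)` (pull-backs preserve Hodge types), `m • y' = (σ^* z)|` off a proper
closed `Z' ⊆ X'`, and the relation is transported down to `X ∖ T`, `T = σ(Z') ∪ (X ∖ U)`, along the
homeomorphism `(X' ∖ σ⁻¹T)(ℂ) ≃ₜ (X ∖ T)(ℂ)` over the iso locus `U` of `σ`.
[cite: VoisinHodgeI2002, §7.3.2 and Lemma 7.28] [cite: SGA1, Exp. XII Prop. 3.1 (xi)]
[cite: HatcherAT2002, §3.1] -/
theorem hodgeClassesGenericallyDivisible_at_of_isBirational (hX' : IsSmoothProjective n X')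
    (hX : IsSmoothProjective n X) (σ : X' ⟶ X)
    (hσ : Literature.AlgebraicGeometry.Resolution.IsBirational σ.left) {k a b : ℕ}
    (hC' : ∀ z' : singularCohomology ℤ ℤ (ComplexPoints X') k,
      IsOfHodgeType n X' k a b
          (singularCohomology.ringChange (Int.castRingHom ℂ) (ComplexPoints X') k z') →
        ∀ m : ℕ, 1 ≤ m → ∃ Z : Set X'.left, IsClosed Z ∧ Z ≠ Set.univ ∧
          ∃ y : singularCohomology ℤ ℤ (complexPointsCompl X' Z) k, m • y = Res[X', Z, k] z')
    (z : singularCohomology ℤ ℤ (ComplexPoints X) k)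
    (hz : IsOfHodgeType n X k a b
      (singularCohomology.ringChange (Int.castRingHom ℂ) (ComplexPoints X) k z))
    {m : ℕ} (hm : 1 ≤ m) :
    ∃ Z : Set X.left, IsClosed Z ∧ Z ≠ Set.univ ∧
      ∃ y : singularCohomology ℤ ℤ (complexPointsCompl X Z) k, m • y = Res[X, Z, k] z := by
  haveI : IsIntegral X'.left := IsSmoothProjective.isIntegral_holds hX'
  haveI : IsIntegral X.left := IsSmoothProjective.isIntegral_holds hX
  have hσ' := hσ
  obtain ⟨U, -, hU', hiso⟩ := hσ'
  haveI : IsIso (σ.left ∣_ U) := hiso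
  set f : C(ComplexPoints X', ComplexPoints X) := AlgPoints.mapContinuous (L := ℂ) σ with hf
  -- the pull-back `σ^* z` is again of type `(a, b)`
  have hz' : IsOfHodgeType n X' k a b (singularCohomology.ringChange (Int.castRingHom ℂ)
      (ComplexPoints X') k (singularCohomology.map ℤ ℤ f k z)) := by
    rw [singularCohomology.ringChange_map]
    exact hz.map_of_isSmoothProjective hX' hX σ
  obtain ⟨Z', hZ', hZ'ne, y, hy⟩ := hC' _ hz' m hm
  -- the exceptional locus `σ⁻¹(X ∖ U)` is a proper closed subset of `X'`
  have hE : IsClosed (σ.left.base ⁻¹' (U : Set X.left)ᶜ) :=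
    U.2.isClosed_compl.preimage σ.left.continuous
  have hEne : σ.left.base ⁻¹' (U : Set X.left)ᶜ ≠ Set.univ := by
    obtain ⟨x, hx⟩ := hU'.nonempty
    exact fun hu ↦ (hu ▸ Set.mem_univ x : x ∈ σ.left.base ⁻¹' (U : Set X.left)ᶜ) hx
  -- `T = σ(Z') ∪ (X ∖ U)` is closed and `≠ X`
  have hSne : Z' ∪ σ.left.base ⁻¹' (U : Set X.left)ᶜ ≠ Set.univ :=
    genericDivisibilityBounded_union_ne_univ hZ' hE hZ'ne hEne
  obtain ⟨hT, hTne⟩ := genericDivisibilityBounded_image_union_isClosed_ne_univ hX' hX σ U hZ' hSne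
  set T : Set X.left := σ.left.base '' Z' ∪ (U : Set X.left)ᶜ with hTdef
  have hUT : (U : Set X.left)ᶜ ⊆ T := Set.subset_union_right
  have hZ'T : Z' ⊆ σ.left.base ⁻¹' T :=
    (Set.subset_preimage_image _ _).trans (Set.preimage_mono Set.subset_union_left)
  -- on `(X' ∖ σ⁻¹T)(ℂ)`: `(σ^* z)| = m • y|`
  have hyT : Res[X', σ.left.base ⁻¹' T, k] (singularCohomology.map ℤ ℤ f k z) =
      m • singularCohomology.map ℤ ℤ Incl[X', Z', σ.left.base ⁻¹' T, hZ'T] k y := by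
    rw [← map_nsmul, hy, genericDivisibility_restrict_restrict ℤ hZ'T]
  -- transport down along the homeomorphism `(X' ∖ σ⁻¹T)(ℂ) ≃ₜ (X ∖ T)(ℂ)`
  obtain ⟨e, he⟩ := genericDivisibilityBounded_exists_homeomorph_compl hX' hX σ U hUT
  rw [hf, genericDivisibilityBounded_restrict_map σ T k z, ← he] at hyT
  refine ⟨T, hT, hTne, singularCohomology.map ℤ ℤ
    (e.symm : C(complexPointsCompl X T, complexPointsCompl X' (σ.left.base ⁻¹' T))) k
      (singularCohomology.map ℤ ℤ Incl[X', Z', σ.left.base ⁻¹' T, hZ'T] k y), ?_⟩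
  have hinv : ∀ x : singularCohomology ℤ ℤ (complexPointsCompl X T) k,
      singularCohomology.map ℤ ℤ
        (e.symm : C(complexPointsCompl X T, complexPointsCompl X' (σ.left.base ⁻¹' T))) k
        (singularCohomology.map ℤ ℤ
          (e : C(complexPointsCompl X' (σ.left.base ⁻¹' T), complexPointsCompl X T)) k x) = x := by
    intro x
    rw [← ModuleCat.comp_apply, ← singularCohomology.map_comp, Homeomorph.toContinuousMap_comp_symm,
      singularCohomology.map_id, ModuleCat.id_apply]
  rw [← map_nsmul, ← hyT, hinv]

/-- **C1 at `X` from C1 at any smooth projective birational model over `X`**, the crux shape: for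
`σ : X' ⟶ X` birational between smooth projective `2p`-folds, if every integral `(p,p)`-class of degree
`2p` on `X'` is generically `m`-divisible for every `m ≥ 1`, so is every integral `(p,p)`-class of
degree `2p` on `X`. [cite: VoisinHodgeI2002, §7.3.2 and Lemma 7.28] [cite: SGA1, Exp. XII Prop. 3.1 (xi)] -/
theorem hodgeClassesGenericallyDivisible_of_isBirational {p : ℕ} (hX' : IsSmoothProjective (2 * p) X')
    (hX : IsSmoothProjective (2 * p) X) (σ : X' ⟶ X)
    (hσ : Literature.AlgebraicGeometry.Resolution.IsBirational σ.left)
    (hC' : ∀ z' : singularCohomology ℤ ℤ (ComplexPoints X') (2 * p),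
      IsOfHodgeType (2 * p) X' (2 * p) p p
          (singularCohomology.ringChange (Int.castRingHom ℂ) (ComplexPoints X') (2 * p) z') →
        ∀ m : ℕ, 1 ≤ m → ∃ Z : Set X'.left, IsClosed Z ∧ Z ≠ Set.univ ∧
          ∃ y : singularCohomology ℤ ℤ (complexPointsCompl X' Z) (2 * p), m • y = Res[X', Z, 2 * p] z')
    (z : singularCohomology ℤ ℤ (ComplexPoints X) (2 * p))
    (hz : IsOfHodgeType (2 * p) X (2 * p) p p
      (singularCohomology.ringChange (Int.castRingHom ℂ) (ComplexPoints X) (2 * p) z))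
    {m : ℕ} (hm : 1 ≤ m) :
    ∃ Z : Set X.left, IsClosed Z ∧ Z ≠ Set.univ ∧
      ∃ y : singularCohomology ℤ ℤ (complexPointsCompl X Z) (2 * p), m • y = Res[X, Z, 2 * p] z :=
  hodgeClassesGenericallyDivisible_at_of_isBirational hX' hX σ hσ hC' z hz hm

/-! ### The registered sub-goal -/

/-- **Registered sub-goal `stub_hodgeClassesGenericallyDivisible_of_isBirational` of
stmt-HodgeConjecture-18466: the crux C1 DESCENDS along birational morphisms of smooth projective
`2p`-folds** — for `σ : X' ⟶ X` birational, C1 at `X'` implies C1 at `X` (closed form; proof: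
`hodgeClassesGenericallyDivisible_at_of_isBirational` at `n = k = 2p`, type `(p, p)`).
[cite: VoisinHodgeI2002, §7.3.2 and Lemma 7.28] [cite: SGA1, Exp. XII Prop. 3.1 (xi)] -/
theorem stub_hodgeClassesGenericallyDivisible_of_isBirational :
    ∀ ⦃p : ℕ⦄ ⦃X' X : SchemeOver ℂ⦄ (σ : X' ⟶ X), 1 ≤ p → IsSmoothProjective (2 * p) X' →
      IsSmoothProjective (2 * p) X → Literature.AlgebraicGeometry.Resolution.IsBirational σ.left →
      (∀ z' : singularCohomology ℤ ℤ (ComplexPoints X') (2 * p),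
        IsOfHodgeType (2 * p) X' (2 * p) p p
            (singularCohomology.ringChange (Int.castRingHom ℂ) (ComplexPoints X') (2 * p) z') →
          ∀ m : ℕ, 1 ≤ m → ∃ Z : Set X'.left, IsClosed Z ∧ Z ≠ Set.univ ∧
            ∃ y : singularCohomology ℤ ℤ (complexPointsCompl X' Z) (2 * p),
              m • y = singularCohomology.map ℤ ℤ
                (⟨Subtype.val, continuous_subtype_val⟩ :
                  C(complexPointsCompl X' Z, ComplexPoints X')) (2 * p) z') →
      ∀ z : singularCohomology ℤ ℤ (ComplexPoints X) (2 * p),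
        IsOfHodgeType (2 * p) X (2 * p) p p
            (singularCohomology.ringChange (Int.castRingHom ℂ) (ComplexPoints X) (2 * p) z) →
          ∀ m : ℕ, 1 ≤ m → ∃ Z : Set X.left, IsClosed Z ∧ Z ≠ Set.univ ∧
            ∃ y : singularCohomology ℤ ℤ (complexPointsCompl X Z) (2 * p),
              m • y = singularCohomology.map ℤ ℤ
                (⟨Subtype.val, continuous_subtype_val⟩ :
                  C(complexPointsCompl X Z, ComplexPoints X)) (2 * p) z :=
  fun _ _ _ σ _ hX' hX hσ hC' z hz _ hm ↦
    hodgeClassesGenericallyDivisible_at_of_isBirational hX' hX σ hσ hC' z hz hm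

end Summit.HodgeConjecture.HodgeConjecture.Theorems

end
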